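import Literature.Analysis.FluidPDE.QuasiSelfSimilarMoveSP00Checks1
import Literature.Analysis.FluidPDE.QuasiSelfSimilarMoveSC
import HarnessLib

/-!
# Straight move, phase 0: assembled checks and the slot

Topic `Literature/Analysis/FluidPDE`. Emitted data / kernel certificates of the explicit straight generating
move (`S`) in the typed-chain model, under the contract of `PlanarGeneratorAssembly.lean`
(`acm_compatible_blocks_of_slots`). Generated by the author's emitter from the exact rational design;
no named facts, every theorem is decided in the kernel or assembled from decided chunks. [folklore]

## References

* G. Alberti, G. Crippa, A. L. Mazzucato, *Exponential self-similar mixing by incompressible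
  flows*, J. Amer. Math. Soc. 32 (2019), 445–490, §8 (arXiv:1605.02090).
-/

noncomputable section

namespace Literature.Analysis.FluidPDE.QuasiSelfSimilar.MoveS

open PlanarKinematics QuasiSelfSimilar

set_option maxHeartbeats 4000000 in
/-- Node count. [folklore] -/
theorem P00_K : P00.K = 13 := by decide +kernel

/-- Kernel check of element validity (all nodes). [folklore] -/
theorem P00_valid : ∀ k < 13, (P00.node k).e.validB = true :=
  (forall_lt_of_chunk (forall_lt_zero fun k => (P00.node k).e.validB = true) P00_valid_c0)

/-- Kernel check of positivity (all nodes). [folklore] -/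
theorem P00_pos : ∀ k < 13, (decide (0 < (P00.node k).box.ρ) && decide (0 < (P00.node k).step.len)) = true :=
  (forall_lt_of_chunk (forall_lt_zero fun k => (decide (0 < (P00.node k).box.ρ) && decide (0 < (P00.node k).step.len)) = true) P00_pos_c0)

/-- Kernel check of the node geometry (orders, pieces, cover tags) (all nodes). [folklore] -/
theorem P00_geo : ∀ k < 13, P00.geomAtB k = true :=
  (forall_lt_of_chunk (forall_lt_zero fun k => P00.geomAtB k = true) P00_geo_c0)

/-- Kernel check of box separation rows (all nodes). [folklore] -/
theorem P00_sep : ∀ k < 13, P00.sepRowB k = true :=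
  (forall_lt_of_chunk (forall_lt_zero fun k => P00.sepRowB k = true) P00_sep_c0)

/-- Kernel check of junction agreement (all nodes). [folklore] -/
theorem P00_agr : ∀ k < 13, P00.agreeAtB k = true :=
  (forall_lt_of_chunk (forall_lt_zero fun k => P00.agreeAtB k = true) P00_agr_c0)

/-- `elemsValidB` of phase 0. [folklore] -/
theorem P00_elemsValidB : P00.elemsValidB = true :=
  PhaseQ.elemsValidB_of_forall (by decide +kernel) (by rw [P00_K]; exact P00_valid)

/-- `allPosB` of phase 0. [folklore] -/
theorem P00_allPosB : P00.allPosB = true :=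
  PhaseQ.allPosB_of_forall (by rw [P00_K]; exact P00_pos)

/-- `geomB` of phase 0. [folklore] -/
theorem P00_geomB : P00.geomB = true :=
  PhaseQ.geomB_of_geomAtB P00_elemsValidB P00_allPosB (by rw [P00_K]; exact P00_geo)

/-- `boxSepB` of phase 0. [folklore] -/
theorem P00_boxSepB : P00.boxSepB = true :=
  PhaseQ.boxSepB_of_sepRowB (by rw [P00_K]; exact P00_sep)

/-- `agreeB` of phase 0. [folklore] -/
theorem P00_agreeB : P00.agreeB = true :=
  PhaseQ.agreeB_of_agreeAtB (by rw [P00_K]; exact P00_agr)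

set_option maxHeartbeats 4000000 in
/-- `gateOKB` of phase 0 on its slot. [folklore] -/
theorem P00_gateOKB : P00.gateOKB C_S stub00 0 = true := by decide +kernel

/-- Slot 0 of the straight move. [folklore] -/
def slot00 : Slot := ⟨P00, 0, stub00, rc00, rc00'⟩
/-- Slot test of slot 0. [folklore] -/
theorem slot00_okB : slot00.okB C_S (genGate .S) (mkRat (3) 200) = true :=
  Slot.okB_intro (s := slot00) P00_geomB P00_boxSepB P00_agreeB P00_gateOKB rfl (by decide)

end Literature.Analysis.FluidPDE.QuasiSelfSimilar.MoveS

end
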